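import Mathlib.Topology.LocallyConstant.Basic
import HarnessLib

/-!
# Locally constant extension across a set with dense complement, from eventual constancy at every point

Topic `Topology`; namespace `Literature.Topology`.  THEOREMS ONLY (no definition, no instance, no notation, no named fact, no `sorry`);
Mathlib-only imports.  Generic topology brick (T) of the road «R1LL-tree» (cell `pub/hodgecm-mathlib`, crux H413 = `stmt-HodgeConjecture-24833`,
LEAD F0P3a-plan (g10) WORD T9-8 (A); architect A-p16 (g27), census `CENSUS-R1LLtree.A-p16g27.md` §4 (T)), but stated with no group theory.

THE STATEMENT.  Let `X` be a topological space, `U ⊆ X` DENSE, `F : X → Y` any function.  Suppose that at EVERY point `x ∈ X` the function `F` is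
«eventually constant along `U`»: there is a value `c_x` with `F y = c_x` for all `y ∈ U` near `x` (at a point of `U` where `F|_U` is locally constant take
`c_x = F x`; at a point outside `U` this is exactly the hypothesis that `F|_U` has a «limit» in the discrete sense).  Then there is a LOCALLY CONSTANT
`g : X → Y` with `g = F` on `U` (`exists_isLocallyConstant_eqOn_of_forall_eventually_eq`).  Proof: `g x := c_x`; on `U`, `c_x = F x` since `x` itself is a
point of `U` near `x`; near `x`, for `y` in the neighbourhood `V_x` where `F|_U ≡ c_x`, the neighbourhood `V_x ∩ V_y` of `y` meets the dense set `U` in a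
point `z` with `c_y = F z = c_x`, so `g ≡ c_x` on `V_x`.  Variant with the two hypotheses separated (`F|_U` locally constant in the relative sense on `U` +
eventual constancy at the points of `Uᶜ`): `exists_isLocallyConstant_eqOn_of_eventually_eq_of_eventually_const`.  The use in the road: `X = C` a compact
torus, `U = C_reg` the regular set (dense, open), `F = Δ·Φ^κ(·, f)` the normalised unstable orbital integral, eventual constancy at the singular points =
the germ computation; the conclusion is the letter's «`∃ f^C` locally constant with `Δ·Φ^κ = f^C` on the regular set» [Rogawski1990 §4.9 Lemma 4.9.3 p. 56].

## References
* [Bourbaki, General Topology I] N. Bourbaki, *General Topology*, Ch. I §8.3 (extension by continuity from a dense subset; here the target is discrete).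
* [Rogawski1990] J. D. Rogawski, *Automorphic Representations of Unitary Groups in Three Variables*, Ann. of Math. Stud. 123 (1990), §4.9 Lemma 4.9.3 p. 56
  (the shape `∃ f^C ∈ C(C)` with a prescribed restriction to the regular set).
-/

open Filter Topology Set

namespace Literature.Topology

variable {X Y : Type*} [TopologicalSpace X]

/-- **Locally constant extension from eventual constancy along a dense set.**  If `U` is dense in `X` and at every point `x` the function `F` is
eventually (near `x`, along `U`) equal to some constant, then `F|_U` is the restriction of a locally constant function on `X`.
[cite: BourbakiGT1, Ch. I §8.3] [cite: Rogawski1990, §4.9 Lemma 4.9.3 p. 56] -/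
theorem exists_isLocallyConstant_eqOn_of_forall_eventually_eq {U : Set X} (hU : Dense U) (F : X → Y)
    (h : ∀ x : X, ∃ c : Y, ∀ᶠ y in 𝓝 x, y ∈ U → F y = c) :
    ∃ g : X → Y, IsLocallyConstant g ∧ EqOn g F U := by
  classical
  choose c hc using h
  refine ⟨c, ?_, ?_⟩
  · -- `c` is constant on the neighbourhood `V_x` of `x` on which `F|_U ≡ c x`
    refine (IsLocallyConstant.iff_eventually_eq c).2 fun x => ?_
    obtain ⟨V, hVmem, hV⟩ : ∃ V ∈ 𝓝 x, ∀ y ∈ V, y ∈ U → F y = c x :=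
      Filter.Eventually.exists_mem (hc x)
    obtain ⟨W, hWV, hWo, hxW⟩ := mem_nhds_iff.1 hVmem
    filter_upwards [hWo.mem_nhds hxW] with y hyW
    -- the neighbourhood `W ∩ V_y` of `y` meets the dense set `U`
    obtain ⟨Vy, hVymem, hVy⟩ : ∃ V' ∈ 𝓝 y, ∀ z ∈ V', z ∈ U → F z = c y :=
      Filter.Eventually.exists_mem (hc y)
    have hmem : W ∩ Vy ∈ 𝓝 y := Filter.inter_mem (hWo.mem_nhds hyW) hVymem
    obtain ⟨z, hzU, hzW, hzVy⟩ := hU.inter_nhds_nonempty hmem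
    rw [← hVy z hzVy hzU, hV z (hWV hzW) hzU]
  · -- on `U`, `c x = F x` (the point `x ∈ U` is near itself)
    intro x hxU
    obtain ⟨V, hVmem, hV⟩ : ∃ V ∈ 𝓝 x, ∀ y ∈ V, y ∈ U → F y = c x :=
      Filter.Eventually.exists_mem (hc x)
    exact (hV x (mem_of_mem_nhds hVmem) hxU).symm

/-- **The same with the two hypotheses separated**: `F|_U` locally constant on `U` in the relative sense (near each `x ∈ U`, `F = F x` along `U`) and,
at each point OUTSIDE `U`, eventually constant along `U`.  [cite: BourbakiGT1, Ch. I §8.3] [cite: Rogawski1990, §4.9 Lemma 4.9.3 p. 56] -/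
theorem exists_isLocallyConstant_eqOn_of_eventually_eq_of_eventually_const {U : Set X} (hU : Dense U) (F : X → Y)
    (hreg : ∀ x ∈ U, ∀ᶠ y in 𝓝 x, y ∈ U → F y = F x)
    (hsing : ∀ x ∉ U, ∃ c : Y, ∀ᶠ y in 𝓝 x, y ∈ U → F y = c) :
    ∃ g : X → Y, IsLocallyConstant g ∧ EqOn g F U :=
  exists_isLocallyConstant_eqOn_of_forall_eventually_eq hU F fun x => by
    by_cases hx : x ∈ U
    · exact ⟨F x, hreg x hx⟩
    · exact hsing x hx

/-- **Subtype form** (the shape the torus application uses: the regular set `U` as a subspace, `F` locally constant ON the subtype `↥U`; `U` need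
not be open): if `F ∘ (↑) : ↥U → Y` is locally constant and `F` is eventually constant along `U` at every point of `Uᶜ`, then some locally constant
`g : X → Y` agrees with `F` on `U`. [cite: BourbakiGT1, Ch. I §8.3] [cite: Rogawski1990, §4.9 Lemma 4.9.3 p. 56] -/
theorem exists_isLocallyConstant_eqOn_of_isLocallyConstant_restrict {U : Set X} (hU : Dense U) (F : X → Y)
    (hreg : IsLocallyConstant (fun u : ↥U => F u))
    (hsing : ∀ x ∉ U, ∃ c : Y, ∀ᶠ y in 𝓝 x, y ∈ U → F y = c) :
    ∃ g : X → Y, IsLocallyConstant g ∧ EqOn g F U := by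
  refine exists_isLocallyConstant_eqOn_of_eventually_eq_of_eventually_const hU F (fun x hx => ?_) hsing
  -- transport the relative local constancy at `⟨x, hx⟩ : ↥U` to `𝓝 x` (`𝓝 ⟨x, hx⟩ = comap (↑) (𝓝 x)`)
  have hev : ∀ᶠ u : ↥U in 𝓝 (⟨x, hx⟩ : ↥U), F (u : X) = F x := (IsLocallyConstant.iff_eventually_eq _).1 hreg ⟨x, hx⟩
  rw [nhds_subtype, Filter.eventually_comap] at hev
  filter_upwards [hev] with y hy hyU using hy ⟨y, hyU⟩ rfl

end Literature.Topology
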